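import Mathlib
import Literature.Probability.Percolation.MinOpenCut
import Summits.CriticalPhenomena.PercolationContinuityZ3.Theses.PercBudgetLadder
import Summits.CriticalPhenomena.PercolationContinuityZ3.Theorems.DefectDimension.Negative.AllOpenCutsets
import Summits.CriticalPhenomena.PercolationContinuityZ3.Theorems.PercBudgetLadderDefectDimensionStubPacking

/-!
# Line `chemical-tortuosity-packing` — skeleton for crux `DefectDimension` (stmt-CriticalPhenomena-5250)

Lead: prover-line-stmt-CriticalPhenomena-5250-0 (rev 2, 2026-08-16: stub statements made DEF-FREE so
that the workers' `--supports` files can state them verbatim over tree declarations only; the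
mathematics of the planner's skeleton `Lines/chemical-tortuosity-packing.lean` is unchanged).

Route `PercBudgetLadder`, rung r4:
`DefectDimension : ∃ c > 0, P_{p_c(ℤ³)}(MinCut(n,2n) ≤ n^{2-c}) → 1`, where `MinCut(n,2n) ≤ b` is the
budget event `budgetEvent n b` of `Theorems/DefectDimension/Negative/AllOpenCutsets.lean` (verbatim
the set of the route item with the budget abstracted).

THE LINE (idea card `Ideas/chemical-tortuosity-packing.md`, merged per triage r1 with the lever of
`Ideas/coarea-chemical-tortuosity.md`, wrapped in the δ-form of `Ideas/shell-product-bootstrap.md`):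

* `stub_packing` (B1 / co-area, deterministic, provable now): for a LATTICE configuration
  `ω ⊆ E(ℤ³)` (triage F1 fix), if every open walk inside `B(2n)` from `B(n)` to `∂ⁱⁿB(2n)` has
  length `≥ ℓ > 0`, then the `⌈ℓ⌉` chemical BFS layers `E_j` (open edges between chemical distance
  `j` and `j+1` from `B(n)`) are pairwise disjoint open cutsets among the `12n(4n+1)² ≤ 3(4n+1)³`
  lattice edges of `B(2n)`, so `MinCut(n,2n) ≤ 3(4n+1)³/ℓ`.
* `stub_weakTortuosity` (T_δ, the open core = the card's Transfer C⁺ in δ-form): for some `s, δ > 0`,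
  at every large scale, with probability `≥ δ` every open crossing of `A(n,2n)` inside `B(2n)` has
  `≥ n^{1+s}` edges (chemical distance across a critical annulus is a power above Euclidean;
  numerically `d_min(ℤ³,p_c) = 1.3756(6)`).
* `stub_bootstrap` (weak-to-strong for the budget functional, provable now): a power saving with
  probability merely `≥ δ` at every large scale upgrades to a (smaller) power saving with probability
  `→ 1`. Lead's proof route (replacing the card's dyadic shells): ONE scale suffices —
  `Var MinCut(n,2n) ≤ p(1-p)·#edgesIn(B(2n)) ≤ 6(4n+1)³` by the tree's PROVED
  `bondPercolation_variance_le_of_bounded_differences` (MinCut is local and 1-Lipschitz), so by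
  Chebyshev the events `{MinCut ≤ n^{2-c}}` (probability `≥ δ`) and `{MinCut > E MinCut - t}`,
  `t = √(6(4n+1)³/δ') `, `δ' < δ`, must meet: `E MinCut ≤ n^{2-c} + C n^{3/2}`, and Markov/Chebyshev
  again gives probability `→ 1` at budget `n^{2-c'}` for any `c' < min(c, 1/2)`.
* `line_composition` (kernel-checked, no `sorry`; hypotheses = the three stub statements verbatim):
  packing + T_δ give the weak form `W(s/2, δ)` (a.s. `ω ⊆ E(ℤ³)`; `3(4n+1)³/n^{1+s} ≤ n^{2-s/2}`
  eventually), and the bootstrap turns `W` into the crux's definiens; `DefectDimension_of` applies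
  it to the stubs and concludes the crux BY NAME (no `Prop` hypotheses, direct `sorry` only inside
  `stub_*`).

Disproof.lean (cdisprove rev 2026-08-16T01:18Z) honoured: no `_false_without_` theorem exists; §2.4
(`sq_le_ncard_of_isEdgeCutsetIn`: cutsets must be random and the parameter must be critical) — the
layers `E_j` are configuration-dependent and criticality enters exactly at `stub_weakTortuosity`
(T_δ is false at `p = 1`, where `L_chem = n`, matching `Negative.defectDimension_false_at_one`, and
vacuously true below `p_c`, matching `Negative.defectDimension_shape_below_critical`); §3
`saving_le_two`: the line's saving `c = s/2 < 0.19 ≤ 2`; §2.1 `budgetEvent_zero`: all stubs are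
vacuous or unused at `n = 0` (`stub_packing` needs `0 < ℓ`, the composition works eventually in `n`).
-/

noncomputable section

open MeasureTheory Filter Topology
open Literature.Probability.Percolation Literature.Probability.LatticeModels
open Summit.CriticalPhenomena.PercolationContinuityZ3.Theorems.DefectDimension.Negative (budgetEvent
  budgetEvent_mono_budget)

namespace Summit.CriticalPhenomena.PercolationContinuityZ3.Cruxes.DefectDimension.ChemicalTortuosityPacking

/-! ## Registered stubs (DEF-FREE statements over tree declarations: `budgetEvent` is
`Theorems.DefectDimension.Negative.budgetEvent`; everything else is Literature / Mathlib)

Tortuosity event, spelled out inside the stubs: `ω` is such that every walk `w` of the open graph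
`openGraph ω` induced on `box 3 (2n)` from a vertex `x ∈ box 3 n` to a vertex
`y ∈ innerBoundary (zdGraph 3) (box 3 (2n))` has `ℓ ≤ w.length` — i.e. the chemical distance inside
`B(2n)` from `B(n)` to `∂ⁱⁿB(2n)` is `≥ ℓ` (vacuously so when the annulus is blocked). -/

/-- **stub_packing — LANDED** (p76643, `Theorems/PercBudgetLadderDefectDimensionStubPacking.lean`,
`Summit.CriticalPhenomena.PercolationContinuityZ3.Theorems.stub_packing`): chemical-layer packing —
for a lattice configuration, if every open walk inside `B(2n)` from `B(n)` to `∂ⁱⁿB(2n)` has length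
`≥ ℓ > 0` then `ω ∈ budgetEvent n (3(4n+1)³/ℓ)`. Re-exported here under the registered name. -/
theorem stub_packing :
    ∀ (n : ℕ) (ℓ : ℝ) (ω : BondConfig (Site 3)), ω ⊆ (zdGraph 3).edgeSet → 0 < ℓ →
      (∀ x y : ((box 3 (2 * n) : Finset (Site 3)) : Set (Site 3)),
        (x : Site 3) ∈ box 3 n → (y : Site 3) ∈ innerBoundary (zdGraph 3) (box 3 (2 * n)) →
        ∀ w : ((openGraph ω).induce ((box 3 (2 * n) : Finset (Site 3)) : Set (Site 3))).Walk x y,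
          ℓ ≤ (w.length : ℝ)) →
      ω ∈ budgetEvent n (3 * (4 * (n : ℝ) + 1) ^ 3 / ℓ) :=
  Summit.CriticalPhenomena.PercolationContinuityZ3.Theorems.stub_packing

/-- **stub_weakTortuosity (T_δ, crossing tortuosity at `p_c(ℤ³)` in δ-form; the open core, size XL).**
For some `s > 0` and `δ > 0`, at every large scale `n`, with `P_{p_c}`-probability at least `δ` every
open walk inside `B(2n)` from `B(n)` to `∂ⁱⁿB(2n)` has at least `n^{1+s}` edges. (Physically true with
margin: the shortest crossing scales like `n^{d_min}`, `d_min = 1.3756(6)`, Zhou–Yang–Deng–Ziff 2012;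
`d_min = 2` above six dimensions, Kozma–Nachmias 2009, so the statement is dimension-robust and does
not imply any crossing-probability bound. Engine on offer: Aizenman–Burchard 1999 Thm 3 from the
single-tube bound H2 — the co-area card's optional second layer.) -/
theorem stub_weakTortuosity :
    ∃ s δ : ℝ, 0 < s ∧ 0 < δ ∧
      ∀ᶠ n : ℕ in atTop, δ ≤ (bondPercolation (zdGraph 3) (criticalProbI 3)).real
        {ω | ∀ x y : ((box 3 (2 * n) : Finset (Site 3)) : Set (Site 3)),
          (x : Site 3) ∈ box 3 n → (y : Site 3) ∈ innerBoundary (zdGraph 3) (box 3 (2 * n)) →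
          ∀ w : ((openGraph ω).induce ((box 3 (2 * n) : Finset (Site 3)) : Set (Site 3))).Walk x y,
            (n : ℝ) ^ (1 + s) ≤ (w.length : ℝ)} := by
  sorry

/-- **stub_bootstrap (weak-to-strong principle for the min-cut budget; provable now, size M).** If for
some `c, δ > 0` the budget event `MinCut(n,2n) ≤ n^{2-c}` has probability `≥ δ` at every large scale,
then for some `c' > 0` the event `MinCut(n,2n) ≤ n^{2-c'}` has probability `→ 1`. Proof route (lead,
one scale, no shells): `MinCut(n,2n)` read through the lattice edges `F = edgesIn (zdGraph 3)
(box 3 (2n))` is measurable, bounded by `#F`, determined by `F` and 1-Lipschitz, so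
`Var ≤ p_c(1-p_c)·#F ≤ 6(4n+1)³` (`bondPercolation_variance_le_of_bounded_differences`, PROVED in
`Literature/Probability/Percolation/BondPercolationEfronStein.lean`); Chebyshev: the events
`{MinCut ≤ n^{2-c}}` (prob `≥ δ`) and `{|MinCut - E MinCut| < √(2·6(4n+1)³/δ)}` (prob `> 1 - δ/2`)
intersect, so `E MinCut ≤ n^{2-c} + √(12(4n+1)³/δ) ≤ 2 n^{2-c₀}` eventually, `c₀ = min(c, 1/2)/... `;
Chebyshev again at level `n^{2-c'}`, `c' = c₀/2`: `P(MinCut > n^{2-c'}) ≤ Var/(n^{2-c'} - E)² → 0`.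
(The card's dyadic-shell route (N)+(U) proves the same signature and remains admissible.) -/
theorem stub_bootstrap :
    (∃ c δ : ℝ, 0 < c ∧ 0 < δ ∧
        ∀ᶠ n : ℕ in atTop, δ ≤ (bondPercolation (zdGraph 3) (criticalProbI 3)).real
          (budgetEvent n ((n : ℝ) ^ (2 - c)))) →
      ∃ c : ℝ, 0 < c ∧
        Tendsto (fun n : ℕ => (bondPercolation (zdGraph 3) (criticalProbI 3)).real
          (budgetEvent n ((n : ℝ) ^ (2 - c)))) atTop (𝓝 1) := by
  sorry

/-! ## Composition (kernel-checked, no `sorry`) -/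

/-- Arithmetic of the exchange rate: `3(4n+1)³ / n^{1+s} ≤ n^{2-s/2}` for all large `n`. -/
theorem packing_budget_eventually_le {s : ℝ} (hs : 0 < s) :
    ∀ᶠ n : ℕ in atTop,
      3 * (4 * (n : ℝ) + 1) ^ 3 / (n : ℝ) ^ (1 + s) ≤ (n : ℝ) ^ (2 - s / 2) := by
  have h1 : Tendsto (fun n : ℕ => (n : ℝ) ^ (-(s / 2))) atTop (𝓝 0) :=
    (tendsto_rpow_neg_atTop (by linarith : 0 < s / 2)).comp tendsto_natCast_atTop_atTop
  have h2 : ∀ᶠ n : ℕ in atTop, (n : ℝ) ^ (-(s / 2)) < 1 / 375 :=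
    h1.eventually (gt_mem_nhds (by norm_num))
  filter_upwards [h2, eventually_ge_atTop 1] with n hn hn1
  have hpos : (0 : ℝ) < n := by exact_mod_cast hn1
  have hone : (1 : ℝ) ≤ n := by exact_mod_cast hn1
  have hA : 0 < (n : ℝ) ^ (s / 2) := Real.rpow_pos_of_pos hpos _
  have hns : 375 < (n : ℝ) ^ (s / 2) := by
    rw [Real.rpow_neg hpos.le, inv_lt_comm₀ hA (by norm_num)] at hn
    norm_num at hn
    exact hn
  rw [div_le_iff₀ (Real.rpow_pos_of_pos hpos _), ← Real.rpow_add hpos]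
  have hexp : 2 - s / 2 + (1 + s) = s / 2 + ((3 : ℕ) : ℝ) := by push_cast; ring
  rw [hexp, Real.rpow_add_natCast hpos.ne']
  have h45 : (4 * (n : ℝ) + 1) ^ 3 ≤ (5 * n) ^ 3 := by gcongr; linarith
  calc 3 * (4 * (n : ℝ) + 1) ^ 3 ≤ 3 * (5 * n) ^ 3 := by linarith [h45]
    _ = 375 * (n : ℝ) ^ 3 := by ring
    _ ≤ (n : ℝ) ^ (s / 2) * (n : ℝ) ^ 3 := by gcongr

/-- **Composition lemma (sorry-free, hypotheses = the three stub statements verbatim).**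
`packing → weak tortuosity → bootstrap → (∃ c > 0, P_{p_c}(MinCut(n,2n) ≤ n^{2-c}) → 1)`, the
conclusion being the crux UNFOLDED (`budgetEvent` form; `DefectDimension_of` below restates it by
name): on the a.s. event `ω ⊆ E(ℤ³)`, tortuosity at level `n^{1+s}` and packing give the budget
`3(4n+1)³/n^{1+s} ≤ n^{2-s/2}`, so the weak form holds with `(c, δ) = (s/2, δ)`; the bootstrap
upgrades it to probability `→ 1`. -/
theorem line_composition
    (hP : ∀ (n : ℕ) (ℓ : ℝ) (ω : BondConfig (Site 3)), ω ⊆ (zdGraph 3).edgeSet → 0 < ℓ →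
      (∀ x y : ((box 3 (2 * n) : Finset (Site 3)) : Set (Site 3)),
        (x : Site 3) ∈ box 3 n → (y : Site 3) ∈ innerBoundary (zdGraph 3) (box 3 (2 * n)) →
        ∀ w : ((openGraph ω).induce ((box 3 (2 * n) : Finset (Site 3)) : Set (Site 3))).Walk x y,
          ℓ ≤ (w.length : ℝ)) →
      ω ∈ budgetEvent n (3 * (4 * (n : ℝ) + 1) ^ 3 / ℓ))
    (hT : ∃ s δ : ℝ, 0 < s ∧ 0 < δ ∧
      ∀ᶠ n : ℕ in atTop, δ ≤ (bondPercolation (zdGraph 3) (criticalProbI 3)).real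
        {ω | ∀ x y : ((box 3 (2 * n) : Finset (Site 3)) : Set (Site 3)),
          (x : Site 3) ∈ box 3 n → (y : Site 3) ∈ innerBoundary (zdGraph 3) (box 3 (2 * n)) →
          ∀ w : ((openGraph ω).induce ((box 3 (2 * n) : Finset (Site 3)) : Set (Site 3))).Walk x y,
            (n : ℝ) ^ (1 + s) ≤ (w.length : ℝ)})
    (hB : (∃ c δ : ℝ, 0 < c ∧ 0 < δ ∧
        ∀ᶠ n : ℕ in atTop, δ ≤ (bondPercolation (zdGraph 3) (criticalProbI 3)).real
          (budgetEvent n ((n : ℝ) ^ (2 - c)))) →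
      ∃ c : ℝ, 0 < c ∧
        Tendsto (fun n : ℕ => (bondPercolation (zdGraph 3) (criticalProbI 3)).real
          (budgetEvent n ((n : ℝ) ^ (2 - c)))) atTop (𝓝 1)) :
    ∃ c : ℝ, 0 < c ∧
      Tendsto (fun n : ℕ => (bondPercolation (zdGraph 3) (criticalProbI 3)).real
        (budgetEvent n ((n : ℝ) ^ (2 - c)))) atTop (𝓝 1) := by
  obtain ⟨s, δ, hs, hδ, hev⟩ := hT
  set Pc : Measure (BondConfig (Site 3)) := bondPercolation (zdGraph 3) (criticalProbI 3) with hPc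
  -- a.s. the configuration lives on the lattice
  have hae : ∀ᵐ ω ∂Pc, ω ⊆ (zdGraph 3).edgeSet := by
    rw [hPc, bondPercolation]
    exact ProbabilityTheory.setBernoulli_ae_subset
  -- the weak form W(s/2, δ)
  have hW : ∃ c δ : ℝ, 0 < c ∧ 0 < δ ∧
      ∀ᶠ n : ℕ in atTop, δ ≤ Pc.real (budgetEvent n ((n : ℝ) ^ (2 - c))) := by
    refine ⟨s / 2, δ, by linarith, hδ, ?_⟩
    filter_upwards [hev, packing_budget_eventually_le hs, eventually_ge_atTop 1] with n hn hle hn1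
    have hpos : (0 : ℝ) < n := by exact_mod_cast hn1
    have hℓ : 0 < (n : ℝ) ^ (1 + s) := Real.rpow_pos_of_pos hpos _
    calc δ ≤ Pc.real {ω | ∀ x y : ((box 3 (2 * n) : Finset (Site 3)) : Set (Site 3)),
          (x : Site 3) ∈ box 3 n → (y : Site 3) ∈ innerBoundary (zdGraph 3) (box 3 (2 * n)) →
          ∀ w : ((openGraph ω).induce ((box 3 (2 * n) : Finset (Site 3)) : Set (Site 3))).Walk x y,
            (n : ℝ) ^ (1 + s) ≤ (w.length : ℝ)} := hn
      _ ≤ Pc.real (budgetEvent n (3 * (4 * (n : ℝ) + 1) ^ 3 / (n : ℝ) ^ (1 + s))) := by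
          rw [measureReal_def, measureReal_def]
          refine ENNReal.toReal_mono (measure_ne_top _ _) (measure_mono_ae ?_)
          filter_upwards [hae] with ω hωE hω
          exact hP n _ ω hωE hℓ hω
      _ ≤ Pc.real (budgetEvent n ((n : ℝ) ^ (2 - s / 2))) :=
          measureReal_mono (budgetEvent_mono_budget hle)
  exact hB hW

/-- **The line concludes the crux BY NAME.** `DefectDimension` (the route decl, whose definiens is
literally the conclusion of `line_composition` with `budgetEvent` unfolded) from the three
registered stubs; no `sorry` of its own — its only non-standard axiom is the `sorryAx` of the stubs it
invokes, which disappears as they are proved. -/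
theorem DefectDimension_of :
    Summit.CriticalPhenomena.PercolationContinuityZ3.Theses.PercBudgetLadder.DefectDimension :=
  line_composition stub_packing stub_weakTortuosity stub_bootstrap

end Summit.CriticalPhenomena.PercolationContinuityZ3.Cruxes.DefectDimension.ChemicalTortuosityPacking

end
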